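import Literature.NumberTheory.GaloisRepresentations.ContinuousCohomologySESFiniteness
import HarnessLib

/-!
# Two-out-of-three for the Euler-characteristic identity along a short exact sequence of discrete
# modules (Milne, *Arithmetic Duality Theorems*, I §5 Lemma 5.3: "`φ` is multiplicative")

Topic `NumberTheory/GaloisRepresentations`; namespace `Literature.NumberTheory.GaloisRepresentations`
(dot notation under `IsSES`).  THEOREMS ONLY (no definition, no named fact, no `sorry`, no instance;
D-0026).  Sequel of `ContinuousCohomologyNineTerm.lean` (`IsSES.card_nineTerm`) and
`ContinuousCohomologySESFiniteness.lean` (`IsSES.card_nineTerm_euler`, `H⁰` as invariants).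

The dévissage form consumed in the proof of Tate's global Euler–Poincaré characteristic formula
(Milne I §5, Lemma 5.3 "`φ` … is multiplicative in short exact sequences" and the reduction after it,
"it suffices to prove the theorem for `M` killed by `p` … simple"; Serre II §5.4): writing

  `EPC_e(M) :⟺ #H⁰(Γ, M) · #H²(Γ, M) · #M^e = #H¹(Γ, M)`

(all `Hⁿ` Mathlib's `continuousCohomology n`, the shape of the tree's
`ContinuousRep.euler_coindOpen_iff`; `e = r₂(K)` at a totally complex number field), for a short exact
sequence `0 → M₁ → M₂ → M₃ → 0` of finite discrete `Γ`-modules with `H³(Γ, M₁) = 0` and finite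
`H¹(Mᵢ)`, `H²(M₁)`, `H²(M₂)`, ANY TWO of `EPC_e(M₁)`, `EPC_e(M₂)`, `EPC_e(M₃)` IMPLY THE THIRD
(`IsSES.euler_X₁`, `euler_X₂`, `euler_X₃`).  No definition is introduced: `EPC_e` is spelled out.
Also `natCard_continuousCohomology_zero_eq_invariants` (`#H⁰_cont = #M^Γ`, Mathlib `zeroIso`) and the
count `card_nineTerm_euler_zero` in this currency.

## References
* J. S. Milne, *Arithmetic Duality Theorems*, 2nd ed. (2006), I §5 Lemma 5.3 (p. 69), I §2 Thm. 2.8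
  (proof). [MilneADT2006]
* J.-P. Serre, *Cohomologie galoisienne* / *Galois Cohomology* (1997), I §2.2, II §5.4.
  [SerreGaloisCohomology1997]
* R. Greenberg, *On the structure of certain Galois cohomology groups*, Doc. Math. (2006), §3 A
  (p. 358). [Greenberg2006]
-/

noncomputable section

open CategoryTheory Function

universe u

namespace Literature.NumberTheory.GaloisRepresentations

open _root_.TopRep _root_.ContRepresentation _root_.ContinuousCohomology

/-! ### Two-out-of-three for the Euler-characteristic identity (`H⁰` as `continuousCohomology 0`)

The dévissage form actually consumed in the proof of Tate's formula (Milne I §5, after Lemma 5.3: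
"it suffices to prove the theorem for `M` killed by `p` … for `M` simple"): writing
`EPC_e(M) :⟺ #H⁰(Γ, M) · #H²(Γ, M) · #M^e = #H¹(Γ, M)` (all `Hⁿ` Mathlib's `continuousCohomology n`,
the shape of the tree's `ContinuousRep.euler_coindOpen_iff`), for a short exact sequence with
`H³(Γ, M₁) = 0` and finite `H¹`, `H²`, any two of `EPC_e(M₁)`, `EPC_e(M₂)`, `EPC_e(M₃)` imply the
third.  No definition is introduced: `EPC_e` is spelled out in each statement. -/

section Zero

variable {R : Type*} [Ring R] [TopologicalSpace R]
variable {G : Type u} [Group G] [TopologicalSpace G] [IsTopologicalGroup G]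

/-- **`#H⁰_cont(G, X) = #X^G`** (Mathlib's `ContinuousCohomology.zeroIso`; "`H⁰(G, D) = D^G` is just
an `R`-submodule of `D`"). [cite: Greenberg2006, §3 A (p. 358 L35–36)]
[cite: SerreGaloisCohomology1997, I §2.2] -/
theorem natCard_continuousCohomology_zero_eq_invariants (X : TopRep.{u} R G) :
    Nat.card (continuousCohomology 0 X) = Nat.card X.ρ.invariants :=
  Nat.card_congr
    ((ContinuousCohomology.zeroIso X).toContinuousLinearEquiv.toLinearEquiv.toEquiv.trans
      (Equiv.subtypeEquivProp rfl))

end Zero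

section EulerIdentity

variable {A : Type*} [CommRing A] [TopologicalSpace A]
variable {Γ : Type u} [Group Γ] [TopologicalSpace Γ] [IsTopologicalGroup Γ] [LocallyCompactSpace Γ]
variable {M₁ : Type u} [AddCommGroup M₁] [Module A M₁] [TopologicalSpace M₁] [DiscreteTopology M₁]
  [ContinuousSMul A M₁]
variable {M₂ : Type u} [AddCommGroup M₂] [Module A M₂] [TopologicalSpace M₂] [DiscreteTopology M₂]
  [ContinuousSMul A M₂]
variable {M₃ : Type u} [AddCommGroup M₃] [Module A M₃] [TopologicalSpace M₃] [DiscreteTopology M₃]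
  [ContinuousSMul A M₃]
variable {ρ₁ : ContinuousRep Γ A M₁} {ρ₂ : ContinuousRep Γ A M₂} {ρ₃ : ContinuousRep Γ A M₃}
variable {f : ρ₁.toTopRep ⟶ ρ₂.toTopRep} {g : ρ₂.toTopRep ⟶ ρ₃.toTopRep}

namespace IsSES

/-- **The nine-term count with `H⁰` as `continuousCohomology 0` and the orders folded in**: for any
`e : ℕ`,
`(#H⁰(M₂)·#H²(M₂)·#M₂^e) · #H¹(M₁) · #H¹(M₃) = #H¹(M₂) · (#H⁰(M₁)·#H²(M₁)·#M₁^e) · (#H⁰(M₃)·#H²(M₃)·#M₃^e)`.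
[cite: MilneADT2006, I §5 Lemma 5.3 (p. 69)] [cite: SerreGaloisCohomology1997, I §2.2, II §5.4] -/
theorem card_nineTerm_euler_zero (h : IsSES f g) [Subsingleton (continuousCohomology 3 ρ₁.toTopRep)]
    [Finite M₂] [Finite M₃]
    [Finite (continuousCohomology 1 ρ₁.toTopRep)] [Finite (continuousCohomology 1 ρ₂.toTopRep)]
    [Finite (continuousCohomology 1 ρ₃.toTopRep)] [Finite (continuousCohomology 2 ρ₁.toTopRep)]
    [Finite (continuousCohomology 2 ρ₂.toTopRep)] (e : ℕ) :
    Nat.card (continuousCohomology 0 ρ₂.toTopRep) * Nat.card (continuousCohomology 2 ρ₂.toTopRep) *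
          Nat.card M₂ ^ e *
        Nat.card (continuousCohomology 1 ρ₁.toTopRep) * Nat.card (continuousCohomology 1 ρ₃.toTopRep) =
      Nat.card (continuousCohomology 1 ρ₂.toTopRep) *
        (Nat.card (continuousCohomology 0 ρ₁.toTopRep) * Nat.card (continuousCohomology 2 ρ₁.toTopRep) *
          Nat.card M₁ ^ e) *
        (Nat.card (continuousCohomology 0 ρ₃.toTopRep) * Nat.card (continuousCohomology 2 ρ₃.toTopRep) *
          Nat.card M₃ ^ e) := by
  rw [natCard_continuousCohomology_zero_eq_invariants ρ₁.toTopRep,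
    natCard_continuousCohomology_zero_eq_invariants ρ₂.toTopRep,
    natCard_continuousCohomology_zero_eq_invariants ρ₃.toTopRep]
  exact h.card_nineTerm_euler e

/-- **Two out of three, middle term: `EPC_e(M₁)` and `EPC_e(M₃)` give `EPC_e(M₂)`**, where
`EPC_e(M) :⟺ #H⁰(Γ, M)·#H²(Γ, M)·#M^e = #H¹(Γ, M)` — for a short exact sequence of finite discrete
`Γ`-modules with `H³(Γ, M₁) = 0` and finite `H¹(Mᵢ)`, `H²(M₁)`, `H²(M₂)`.  (Milne: "`φ` is
multiplicative … it suffices to prove `φ(M) = 1` for simple `M`".)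
[cite: MilneADT2006, I §5 Lemma 5.3 and the reduction after it (p. 69)] -/
theorem euler_X₂ (h : IsSES f g) [Subsingleton (continuousCohomology 3 ρ₁.toTopRep)]
    [Finite M₂] [Finite M₃]
    [Finite (continuousCohomology 1 ρ₁.toTopRep)] [Finite (continuousCohomology 1 ρ₂.toTopRep)]
    [Finite (continuousCohomology 1 ρ₃.toTopRep)] [Finite (continuousCohomology 2 ρ₁.toTopRep)]
    [Finite (continuousCohomology 2 ρ₂.toTopRep)] (e : ℕ)
    (h₁ : Nat.card (continuousCohomology 0 ρ₁.toTopRep) * Nat.card (continuousCohomology 2 ρ₁.toTopRep) *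
        Nat.card M₁ ^ e = Nat.card (continuousCohomology 1 ρ₁.toTopRep))
    (h₃ : Nat.card (continuousCohomology 0 ρ₃.toTopRep) * Nat.card (continuousCohomology 2 ρ₃.toTopRep) *
        Nat.card M₃ ^ e = Nat.card (continuousCohomology 1 ρ₃.toTopRep)) :
    Nat.card (continuousCohomology 0 ρ₂.toTopRep) * Nat.card (continuousCohomology 2 ρ₂.toTopRep) *
        Nat.card M₂ ^ e = Nat.card (continuousCohomology 1 ρ₂.toTopRep) := by
  have E := h.card_nineTerm_euler_zero e
  rw [h₁, h₃] at E
  have h13 : Nat.card (continuousCohomology 1 ρ₁.toTopRep) *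
      Nat.card (continuousCohomology 1 ρ₃.toTopRep) ≠ 0 :=
    mul_ne_zero Nat.card_pos.ne' Nat.card_pos.ne'
  have E' : (Nat.card (continuousCohomology 0 ρ₂.toTopRep) *
        Nat.card (continuousCohomology 2 ρ₂.toTopRep) * Nat.card M₂ ^ e) *
      (Nat.card (continuousCohomology 1 ρ₁.toTopRep) * Nat.card (continuousCohomology 1 ρ₃.toTopRep)) =
      Nat.card (continuousCohomology 1 ρ₂.toTopRep) *
      (Nat.card (continuousCohomology 1 ρ₁.toTopRep) * Nat.card (continuousCohomology 1 ρ₃.toTopRep)) := by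
    calc _ = Nat.card (continuousCohomology 0 ρ₂.toTopRep) * Nat.card (continuousCohomology 2 ρ₂.toTopRep) *
          Nat.card M₂ ^ e * Nat.card (continuousCohomology 1 ρ₁.toTopRep) *
          Nat.card (continuousCohomology 1 ρ₃.toTopRep) := by ring
      _ = Nat.card (continuousCohomology 1 ρ₂.toTopRep) * Nat.card (continuousCohomology 1 ρ₁.toTopRep) *
          Nat.card (continuousCohomology 1 ρ₃.toTopRep) := E
      _ = _ := by ring
  exact mul_right_cancel₀ h13 E'

/-- **Two out of three, right term: `EPC_e(M₁)` and `EPC_e(M₂)` give `EPC_e(M₃)`.**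
[cite: MilneADT2006, I §5 Lemma 5.3 (p. 69)] -/
theorem euler_X₃ (h : IsSES f g) [Subsingleton (continuousCohomology 3 ρ₁.toTopRep)]
    [Finite M₂] [Finite M₃]
    [Finite (continuousCohomology 1 ρ₁.toTopRep)] [Finite (continuousCohomology 1 ρ₂.toTopRep)]
    [Finite (continuousCohomology 1 ρ₃.toTopRep)] [Finite (continuousCohomology 2 ρ₁.toTopRep)]
    [Finite (continuousCohomology 2 ρ₂.toTopRep)] (e : ℕ)
    (h₁ : Nat.card (continuousCohomology 0 ρ₁.toTopRep) * Nat.card (continuousCohomology 2 ρ₁.toTopRep) *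
        Nat.card M₁ ^ e = Nat.card (continuousCohomology 1 ρ₁.toTopRep))
    (h₂ : Nat.card (continuousCohomology 0 ρ₂.toTopRep) * Nat.card (continuousCohomology 2 ρ₂.toTopRep) *
        Nat.card M₂ ^ e = Nat.card (continuousCohomology 1 ρ₂.toTopRep)) :
    Nat.card (continuousCohomology 0 ρ₃.toTopRep) * Nat.card (continuousCohomology 2 ρ₃.toTopRep) *
        Nat.card M₃ ^ e = Nat.card (continuousCohomology 1 ρ₃.toTopRep) := by
  have E := h.card_nineTerm_euler_zero e
  rw [h₁, h₂] at E
  have h12 : Nat.card (continuousCohomology 1 ρ₂.toTopRep) *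
      Nat.card (continuousCohomology 1 ρ₁.toTopRep) ≠ 0 :=
    mul_ne_zero Nat.card_pos.ne' Nat.card_pos.ne'
  have E' : Nat.card (continuousCohomology 1 ρ₃.toTopRep) *
        (Nat.card (continuousCohomology 1 ρ₂.toTopRep) * Nat.card (continuousCohomology 1 ρ₁.toTopRep)) =
      (Nat.card (continuousCohomology 0 ρ₃.toTopRep) * Nat.card (continuousCohomology 2 ρ₃.toTopRep) *
          Nat.card M₃ ^ e) *
        (Nat.card (continuousCohomology 1 ρ₂.toTopRep) * Nat.card (continuousCohomology 1 ρ₁.toTopRep)) := by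
    calc _ = Nat.card (continuousCohomology 1 ρ₂.toTopRep) * Nat.card (continuousCohomology 1 ρ₁.toTopRep) *
          Nat.card (continuousCohomology 1 ρ₃.toTopRep) := by ring
      _ = Nat.card (continuousCohomology 1 ρ₂.toTopRep) * Nat.card (continuousCohomology 1 ρ₁.toTopRep) *
          (Nat.card (continuousCohomology 0 ρ₃.toTopRep) * Nat.card (continuousCohomology 2 ρ₃.toTopRep) *
            Nat.card M₃ ^ e) := E
      _ = _ := by ring
  exact (mul_right_cancel₀ h12 E').symm

/-- **Two out of three, left term: `EPC_e(M₂)` and `EPC_e(M₃)` give `EPC_e(M₁)`.**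
[cite: MilneADT2006, I §5 Lemma 5.3 (p. 69)] -/
theorem euler_X₁ (h : IsSES f g) [Subsingleton (continuousCohomology 3 ρ₁.toTopRep)]
    [Finite M₂] [Finite M₃]
    [Finite (continuousCohomology 1 ρ₁.toTopRep)] [Finite (continuousCohomology 1 ρ₂.toTopRep)]
    [Finite (continuousCohomology 1 ρ₃.toTopRep)] [Finite (continuousCohomology 2 ρ₁.toTopRep)]
    [Finite (continuousCohomology 2 ρ₂.toTopRep)] (e : ℕ)
    (h₂ : Nat.card (continuousCohomology 0 ρ₂.toTopRep) * Nat.card (continuousCohomology 2 ρ₂.toTopRep) *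
        Nat.card M₂ ^ e = Nat.card (continuousCohomology 1 ρ₂.toTopRep))
    (h₃ : Nat.card (continuousCohomology 0 ρ₃.toTopRep) * Nat.card (continuousCohomology 2 ρ₃.toTopRep) *
        Nat.card M₃ ^ e = Nat.card (continuousCohomology 1 ρ₃.toTopRep)) :
    Nat.card (continuousCohomology 0 ρ₁.toTopRep) * Nat.card (continuousCohomology 2 ρ₁.toTopRep) *
        Nat.card M₁ ^ e = Nat.card (continuousCohomology 1 ρ₁.toTopRep) := by
  have E := h.card_nineTerm_euler_zero e
  rw [h₂, h₃] at E
  have h23 : Nat.card (continuousCohomology 1 ρ₂.toTopRep) *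
      Nat.card (continuousCohomology 1 ρ₃.toTopRep) ≠ 0 :=
    mul_ne_zero Nat.card_pos.ne' Nat.card_pos.ne'
  have E' : Nat.card (continuousCohomology 1 ρ₁.toTopRep) *
        (Nat.card (continuousCohomology 1 ρ₂.toTopRep) * Nat.card (continuousCohomology 1 ρ₃.toTopRep)) =
      (Nat.card (continuousCohomology 0 ρ₁.toTopRep) * Nat.card (continuousCohomology 2 ρ₁.toTopRep) *
          Nat.card M₁ ^ e) *
        (Nat.card (continuousCohomology 1 ρ₂.toTopRep) * Nat.card (continuousCohomology 1 ρ₃.toTopRep)) := by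
    calc _ = Nat.card (continuousCohomology 1 ρ₂.toTopRep) * Nat.card (continuousCohomology 1 ρ₁.toTopRep) *
          Nat.card (continuousCohomology 1 ρ₃.toTopRep) := by ring
      _ = Nat.card (continuousCohomology 1 ρ₂.toTopRep) *
          (Nat.card (continuousCohomology 0 ρ₁.toTopRep) * Nat.card (continuousCohomology 2 ρ₁.toTopRep) *
            Nat.card M₁ ^ e) * Nat.card (continuousCohomology 1 ρ₃.toTopRep) := E
      _ = _ := by ring
  exact (mul_right_cancel₀ h23 E').symm

end IsSES

end EulerIdentity

end Literature.NumberTheory.GaloisRepresentations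

end
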